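import Summits.QuantumFields.BalabanUV.Beta.FP.HorizontalBookkeepingTail

/-!
# `BalabanUV.Beta.FP.HorizontalBookkeepingTailPointwise` — road «FP», N7 H-route, row H3-BOOK (b-T), (T1): THE POINTWISE TRANSPORT COMPARISON OF THE
# TAIL — `|N⁸·dressedEntry w (K − truncK K N) (N•v) a b − N⁶·(K − truncK K N) a b (N•v)| ≤ A_out/‖v‖∞⁷` (`‖v‖∞ ≥ 4`) and `≤ 16Cc²β₀² + C` (every `v`),
# the constants FREE OF `N` ([folklore] lattice bookkeeping on `ℤ⁴`; nothing of the manuscripts)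

HONEST DEPENDENCY (page 1, mandatory): continuum YM on T⁴ ⇐ BetaPertH ∧ nine spine estimates (0/9 proved); BetaPertH ⇐ (D1) ∧ (D4) ∧
CAP+tail; G-an2-4 gates asym, D1 and NE2/3/4.  HONEST FRAMING (cell contract, verbatim): «discharging `BetaPertH` makes Bałaban's UV
stability UNCONDITIONAL — a real constructive-QFT result; it is NOT the continuum limit and NOT the Clay problem.»  THIS MODULE composes BY NAME the scalar
engine `FP/HorizontalBookkeepingTail` (`abs_dressedSum_sub_centre_le`, `letter_at_scale`, `abs_tail_le`, `abs_tail_diff_le`, the `ℤ⁴` geometry) with the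
total masses `DressedMomentNormalisation.hasSum_total_of_constReproSum`.  Every analytic input — the decay of `K` and of its first differences, the
Kronecker masses (L0∞) and the exponential transport profile with mass exponent `p = 5` (row IPROF-UNIF's located power; supplied there, NOT here) — is a
HYPOTHESIS displayed in the signatures.  It cites nothing, defines nothing, mints no `Prop` fact, 0 sorry.  NOT the summed form (next module `…TailSum`), NOT
(H3-b)'s assembly (leaf-05's (b3′)/(b4′) + `hgerm`), NOT `hbook`, NOT `hasym`, NOT D1, NOT BetaPertH, NOT continuum, NOT Clay.

ROW: `LEAVES-FP.md` sub-row «H3-BOOK (b-T)» (road FP owner d1-p3-g4, R-FP-15 ∕ `N7-PROOF.v2.md` §3 (H3-b); split with leaf-05-g8).  THE ARGUMENT: at the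
coarse point `y = N•v`, `‖v‖∞ ≥ 4`, take the near box of radius `ρ := N⌊‖v‖∞/4⌋` (`4ρ ≤ N‖v‖∞ ≤ 16ρ`); every `t` in it has `‖t‖∞ ≥ N + 2` and
`(3/4)N‖v‖∞ ≤ ‖t‖∞ + 1` (`box_geometry`), so the tail kernel's first differences there are `≤ B := C(4/3)⁷/(N‖v‖∞)⁷`; everywhere `|tail| ≤ A := C/(N+1)⁶`.
The scalar comparison gives, per entry pair, `4B(P₁Q₀+P₀Q₁) + 128Aρ⁻⁷(P₇Q₀+P₀Q₇)`; the zeroth-order term is EXACT, `Σ_{c,e} tail_{ce}(y)(Σw_{ca})(Σw_{eb}) =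
tail_{ab}(y)·N⁻²` by the masses `Σ_x w κ l x = δ_{κl}N⁻¹`; with the letters `L₀ ≤ cβ₀N⁻¹`, `L₁ ≤ cβ₁`, `L₇ ≤ cβ₇N⁶` at scale `δ/N` every power of `N` cancels:
`16N⁸·(8B·L₁L₀ + 256Aρ⁻⁷L₇L₀) ≤ A_out/‖v‖∞⁷`.

CONTENT.
* §5 `rho_bounds`, `box_geometry`, **`abs_transport_tail_sub_le_of_letters`** (abstract letters `L₀, L₁, L₇`).
* §6 **`abs_transport_tail_sub_le_outer`** (`‖v‖∞ ≥ 4`; `A_out := C·c²·e^{δ/2}²·(1+4/δ)⁸·(128·(4/3)⁷·(2/δ) + 4096·16⁷·5040·(2/δ)⁷)`),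
  **`abs_transport_tail_le_core`** (every `v`: `≤ 16·C·c²·(e^{δ/2}(1+4/δ)⁴)² + C` by power counting, `N⁸·(N+1)⁻⁶·(cβ₀N⁻¹)²` and `N⁶·C(N‖v‖∞+1)⁻⁶`).
Unit `b2b-balaban-beta-d1-formalise-leaf-02` (gen 6).
-/

noncomputable section

namespace Summit.QuantumFields.BalabanUV.Beta.FP.HorizontalBookkeepingTailPointwise

open Finset Filter Topology
open scoped BigOperators
open Literature.MathematicalPhysics.QuantumFieldTheory.Balaban1983to89
open Literature.MathematicalPhysics.QuantumFieldTheory.Balaban1983to89.Beta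
open B12Sec2to5 (l1 l1_nonneg abs_coord_le_l1)
open ExpKernelCalculus (Site Zl Zl_pos l1_sub_triangle l1_sub_symm)
open DecimatedMomentSummable (dressedSum ConstReproSum)
open DressedMomentNormalisation (EKer dressedEntry hasSum_total_of_constReproSum)
open Summit.QuantumFields.BalabanUV.Beta.FP.HorizontalBookkeeping (truncK truncK_apply)
open Summit.QuantumFields.BalabanUV.Beta.FP.HorizontalBookkeepingTail

section Four

open DyadicShell (Pt supNorm natAbs_le_supNorm supNorm_le_iff exists_eq_supNorm corners mem_corners supNorm_le_supNorm_add_corner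
  supNorm_eq_zero_iff)

/-! ## §5 The kernel-level pointwise comparison, OUTER REGION `‖v‖∞ ≥ 4` -/

/-- [folklore] The radius of the near box: `ρ := N·⌊‖v‖∞/4⌋` has `ρ ≥ 1`, `4ρ ≤ N‖v‖∞` and `N‖v‖∞ ≤ 16ρ` for `‖v‖∞ ≥ 4`, `N ≥ 1`. -/
theorem rho_bounds {N n : ℕ} (hN : 1 ≤ N) (hn : 4 ≤ n) :
    1 ≤ N * (n / 4) ∧ 4 * (N * (n / 4)) ≤ N * n ∧ N * n ≤ 16 * (N * (n / 4)) := by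
  have h1 : 1 ≤ n / 4 := (Nat.le_div_iff_mul_le (by norm_num)).mpr (by omega)
  have h2 : 4 * (n / 4) ≤ n := Nat.mul_div_le n 4
  have h3 : n ≤ 16 * (n / 4) := by omega
  refine ⟨Nat.one_le_iff_ne_zero.mpr (Nat.mul_ne_zero_iff.mpr ⟨by omega, by omega⟩) |>.trans' ?_, ?_, ?_⟩
  · exact le_rfl
  · calc 4 * (N * (n / 4)) = N * (4 * (n / 4)) := by ring
      _ ≤ N * n := Nat.mul_le_mul_left _ h2
  · calc N * n ≤ N * (16 * (n / 4)) := Nat.mul_le_mul_left _ h3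
      _ = 16 * (N * (n / 4)) := by ring

/-- [folklore] GEOMETRY OF THE NEAR BOX: every `t` with `|t_i − N v_i| ≤ ρ` (`ρ = N⌊‖v‖∞/4⌋`, `‖v‖∞ ≥ 4`, `N ≥ 1`) has `‖t‖∞ ≥ N + 2` and
`(3/4)·N‖v‖∞ ≤ ‖t‖∞ + 1`. -/
theorem box_geometry {N : ℕ} (hN : 1 ≤ N) {v : Pt} (hv : 4 ≤ supNorm v) {t : Pt}
    (ht : ∀ i, |t i - ((N : ℤ) • v) i| ≤ ((N * (supNorm v / 4) : ℕ) : ℤ)) :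
    N + 2 ≤ supNorm t ∧ (3 / 4 : ℝ) * ((N : ℝ) * supNorm v) ≤ (supNorm t : ℝ) + 1 := by
  obtain ⟨hρ1, hρ4, _⟩ := rho_bounds hN hv
  have hbox := supNorm_le_add_of_box ht
  rw [supNorm_natCast_smul] at hbox
  have hNn : 4 * N ≤ N * supNorm v := by
    calc 4 * N = N * 4 := by ring
      _ ≤ N * supNorm v := Nat.mul_le_mul_left _ hv
  -- in ℕ: 4‖t‖ ≥ 4Nn − 4ρ ≥ 3Nn ≥ 12N
  have h4 : 3 * (N * supNorm v) ≤ 4 * supNorm t := by omega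
  refine ⟨by omega, ?_⟩
  have h4' : (3 : ℝ) * ((N : ℝ) * supNorm v) ≤ 4 * (supNorm t : ℝ) := by exact_mod_cast h4
  linarith

/-- **THE TRANSPORT COMPARISON OF THE TAIL, OUTER REGION, ABSTRACT LETTERS.**  `K : EKer 4` with `|K| ≤ C(‖t‖∞+1)⁻⁶` and
`|Δ_i K| ≤ C(‖t‖∞+1)⁻⁷`; transport entries `w κ l` with the Kronecker masses (L0∞) `δ_{κl}·N⁻⁵`, summable `(|·|₁+1)⁷`-weighted absolute families
and letters `Σ'|w κ l| ≤ L₀`, `Σ'(|x|₁+1)|w κ l x| ≤ L₁`, `Σ'(|x|₁+1)⁷|w κ l x| ≤ L₇` (uniform in `κ, l`); `N ≥ 1`, `‖v‖∞ ≥ 4`, `ρ := N⌊‖v‖∞/4⌋`.  Then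
`|N⁸·dressedEntry w (K − truncK K N) (N•v) a b − N⁶·(K − truncK K N) a b (N•v)|`
`≤ 16·N⁸·(4·(C·(4/3)⁷/(N‖v‖∞)⁷)·(2·L₁·L₀) + 128·(C/(N+1)⁶)/ρ⁷·(2·L₇·L₀))` — zeroth order EXACT by the masses, first-difference remainder in the
near box, uniform smallness of the tail in the far region. [folklore] -/
theorem abs_transport_tail_sub_le_of_letters {K w : EKer 4} {C L₀ L₁ L₇ : ℝ} {N : ℕ} (hN : 1 ≤ N)
    (hK : ∀ c e (t : Pt), |K c e t| ≤ C / ((supNorm t : ℝ) + 1) ^ 6)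
    (hdK : ∀ c e (t : Pt) (i : Fin 4), |K c e (t + Pi.single i 1) - K c e t| ≤ C / ((supNorm t : ℝ) + 1) ^ 7)
    (hw0 : ∀ κ l, ConstReproSum N (w κ l) (if κ = l then (((N : ℝ) ^ (4 + 1))⁻¹) else 0))
    (hwS : ∀ κ l, Summable fun x => (l1 x + 1) ^ 7 * |w κ l x|)
    (hL0 : ∀ κ l, ∑' x, |w κ l x| ≤ L₀) (hL1 : ∀ κ l, ∑' x, (l1 x + 1) * |w κ l x| ≤ L₁)
    (hL7 : ∀ κ l, ∑' x, (l1 x + 1) ^ 7 * |w κ l x| ≤ L₇)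
    (a b : Fin 4) {v : Pt} (hv : 4 ≤ supNorm v) :
    |(N : ℝ) ^ 8 * dressedEntry w (K - truncK K N) ((N : ℤ) • v) a b - (N : ℝ) ^ 6 * (K - truncK K N) a b ((N : ℤ) • v)|
      ≤ 16 * (N : ℝ) ^ 8 * (4 * (C * (4 / 3 : ℝ) ^ 7 / ((N : ℝ) * supNorm v) ^ 7) * (2 * L₁ * L₀)
          + 128 * (C / ((N : ℝ) + 1) ^ 6) / ((N * (supNorm v / 4) : ℕ) : ℝ) ^ 7 * (2 * L₇ * L₀)) := by
  have hNpos : 0 < N := hN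
  have hN' : (1 : ℝ) ≤ N := by exact_mod_cast hN
  have hC := nonneg_of_decay hK a b
  obtain ⟨hρ1, hρ4, hρ16⟩ := rho_bounds hN hv
  set ρ : ℕ := N * (supNorm v / 4) with hρdef
  set T : EKer 4 := K - truncK K N with hT
  set y : Pt := (N : ℤ) • v with hy
  set A : ℝ := C / ((N : ℝ) + 1) ^ 6 with hAdef
  set B : ℝ := C * (4 / 3 : ℝ) ^ 7 / ((N : ℝ) * supNorm v) ^ 7 with hBdef
  have hNn : (0 : ℝ) < (N : ℝ) * supNorm v := by
    have : (4 : ℝ) ≤ supNorm v := by exact_mod_cast hv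
    positivity
  have hB : 0 ≤ B := by positivity
  have hA0 : 0 ≤ A := by positivity
  -- the middle factor: bounded by `A`, first differences `≤ B` on the near box
  have hTA : ∀ c e (t : Pt), |T c e t| ≤ A := fun c e t => abs_tail_le hK c e t
  have hT1 : ∀ c e (t : Pt), (∀ i, |t i - y i| ≤ (ρ : ℤ)) → ∀ i, |T c e (t + Pi.single i 1) - T c e t| ≤ B := by
    intro c e t ht i
    obtain ⟨hfar, hreal⟩ := box_geometry hN hv ht
    refine (abs_tail_diff_le hdK hfar c e i).trans ?_
    have key : ((3 / 4 : ℝ) * ((N : ℝ) * supNorm v)) ^ 7 ≤ ((supNorm t : ℝ) + 1) ^ 7 :=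
      pow_le_pow_left₀ (by positivity) hreal 7
    calc C / ((supNorm t : ℝ) + 1) ^ 7 ≤ C / ((3 / 4 : ℝ) * ((N : ℝ) * supNorm v)) ^ 7 :=
          div_le_div_of_nonneg_left hC (by positivity) key
      _ = B := by rw [hBdef, mul_pow]; field_simp
  -- letters are nonnegative
  have hL0nn : 0 ≤ L₀ := (tsum_nonneg fun x => abs_nonneg (w a a x)).trans (hL0 a a)
  -- one scalar comparison per pair `(c, e)`
  have hpair : ∀ c e : Fin 4,
      |dressedSum (w c a) (T c e) (w e b) y - T c e y * ((∑' u, w c a u) * (∑' x, w e b x))|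
        ≤ 4 * B * (2 * L₁ * L₀) + 128 * A / (ρ : ℝ) ^ 7 * (2 * L₇ * L₀) := by
    intro c e
    have h := abs_dressedSum_sub_centre_le (D := 4) hρ1 hB (hTA c e) (hT1 c e) (hwS c a) (hwS e b)
    refine h.trans ?_
    have n0 : ∀ κ l, 0 ≤ ∑' x, |w κ l x| := fun κ l => tsum_nonneg fun x => abs_nonneg _
    have n1 : ∀ κ l, 0 ≤ ∑' x, (l1 x + 1) * |w κ l x| := fun κ l =>
      tsum_nonneg fun x => mul_nonneg (by linarith [l1_nonneg x]) (abs_nonneg _)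
    have n7 : ∀ κ l, 0 ≤ ∑' x, (l1 x + 1) ^ 7 * |w κ l x| := fun κ l =>
      tsum_nonneg fun x => mul_nonneg (pow_nonneg (by linarith [l1_nonneg x]) _) (abs_nonneg _)
    have e1 : (∑' u, (l1 u + 1) * |w c a u|) * (∑' x, |w e b x|) + (∑' u, |w c a u|) * (∑' x, (l1 x + 1) * |w e b x|)
        ≤ 2 * L₁ * L₀ := by
      have t1 := mul_le_mul (hL1 c a) (hL0 e b) (n0 e b) ((n1 c a).trans (hL1 c a))
      have t2 := mul_le_mul (hL0 c a) (hL1 e b) (n1 e b) ((n0 c a).trans (hL0 c a))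
      linarith
    have e7 : (∑' u, (l1 u + 1) ^ 7 * |w c a u|) * (∑' x, |w e b x|) + (∑' u, |w c a u|) * (∑' x, (l1 x + 1) ^ 7 * |w e b x|)
        ≤ 2 * L₇ * L₀ := by
      have t1 := mul_le_mul (hL7 c a) (hL0 e b) (n0 e b) ((n7 c a).trans (hL7 c a))
      have t2 := mul_le_mul (hL0 c a) (hL7 e b) (n7 e b) ((n0 c a).trans (hL0 c a))
      linarith
    have hAρ : 0 ≤ 128 * A / (ρ : ℝ) ^ 7 := by positivity
    push_cast
    gcongr
  -- the masses: `Σ' w κ l = δ_{κl}·N⁻¹`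
  have hmass : ∀ κ l, ∑' x, w κ l x = if κ = l then ((N : ℝ))⁻¹ else 0 := by
    intro κ l
    rw [(hasSum_total_of_constReproSum hNpos (hw0 κ l)).tsum_eq]
    have hN0 : (N : ℝ) ≠ 0 := by positivity
    split_ifs
    · rw [show (4 + 1 : ℕ) = 5 from rfl, show ((N : ℝ) ^ 5)⁻¹ = ((N : ℝ) ^ 4)⁻¹ * ((N : ℝ))⁻¹ by rw [← mul_inv, ← pow_succ],
        ← mul_assoc, mul_inv_cancel₀ (pow_ne_zero 4 hN0), one_mul]
    · rw [mul_zero]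
  have hzero : ∑ c, ∑ e, T c e y * ((∑' u, w c a u) * (∑' x, w e b x)) = T a b y * ((N : ℝ) ^ 2)⁻¹ := by
    simp only [hmass, mul_ite, ite_mul, mul_zero, zero_mul, Finset.sum_ite_eq', Finset.mem_univ, if_true]
    ring
  -- assemble
  have hsum : |dressedEntry w T y a b - T a b y * ((N : ℝ) ^ 2)⁻¹|
      ≤ 16 * (4 * B * (2 * L₁ * L₀) + 128 * A / (ρ : ℝ) ^ 7 * (2 * L₇ * L₀)) := by
    rw [← hzero]
    unfold dressedEntry
    rw [← Finset.sum_sub_distrib]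
    refine (Finset.abs_sum_le_sum_abs _ _).trans ?_
    have : ∀ c ∈ (Finset.univ : Finset (Fin 4)),
        |∑ e, dressedSum (w c a) (T c e) (w e b) y - ∑ e, T c e y * ((∑' u, w c a u) * (∑' x, w e b x))|
          ≤ 4 * (4 * B * (2 * L₁ * L₀) + 128 * A / (ρ : ℝ) ^ 7 * (2 * L₇ * L₀)) := by
      intro c _
      rw [← Finset.sum_sub_distrib]
      refine (Finset.abs_sum_le_sum_abs _ _).trans ?_
      calc ∑ e, |dressedSum (w c a) (T c e) (w e b) y - T c e y * ((∑' u, w c a u) * (∑' x, w e b x))|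
          ≤ ∑ _e : Fin 4, (4 * B * (2 * L₁ * L₀) + 128 * A / (ρ : ℝ) ^ 7 * (2 * L₇ * L₀)) := Finset.sum_le_sum fun e _ => hpair c e
        _ = _ := by rw [Finset.sum_const, Finset.card_univ, Fintype.card_fin, nsmul_eq_mul]; push_cast; ring
    calc ∑ c, |∑ e, dressedSum (w c a) (T c e) (w e b) y - ∑ e, T c e y * ((∑' u, w c a u) * (∑' x, w e b x))|
        ≤ ∑ _c : Fin 4, 4 * (4 * B * (2 * L₁ * L₀) + 128 * A / (ρ : ℝ) ^ 7 * (2 * L₇ * L₀)) := Finset.sum_le_sum this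
      _ = _ := by rw [Finset.sum_const, Finset.card_univ, Fintype.card_fin, nsmul_eq_mul]; norm_num; ring
  have hN8 : (0 : ℝ) ≤ (N : ℝ) ^ 8 := by positivity
  have e : (N : ℝ) ^ 8 * dressedEntry w T y a b - (N : ℝ) ^ 6 * T a b y
      = (N : ℝ) ^ 8 * (dressedEntry w T y a b - T a b y * ((N : ℝ) ^ 2)⁻¹) := by
    have hN0 : (N : ℝ) ≠ 0 := by positivity
    field_simp
  rw [e, abs_mul, abs_of_nonneg hN8]
  calc (N : ℝ) ^ 8 * |dressedEntry w T y a b - T a b y * ((N : ℝ) ^ 2)⁻¹|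
      ≤ (N : ℝ) ^ 8 * (16 * (4 * B * (2 * L₁ * L₀) + 128 * A / (ρ : ℝ) ^ 7 * (2 * L₇ * L₀))) :=
        mul_le_mul_of_nonneg_left hsum hN8
    _ = _ := by rw [hBdef, hAdef]; ring

end Four


/-! ## §6 The exponential transport profile: explicit `N`-free constants (outer region, core, everywhere) -/

section Profile

open DyadicShell (Pt supNorm supNorm_eq_zero_iff)

/-- **OUTER REGION, EXPLICIT CONSTANT.**  With the exponential profile `|w κ l x| ≤ (c/N⁵)·e^{−(δ/N)|x|₁}` (Kronecker mass exponent `p = 5`,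
the located power of row IPROF-UNIF) the letters are `L₀ ≤ c·β₀·N⁻¹`, `L₁ ≤ c·β₁`, `L₇ ≤ c·β₇·N⁶` (`letter_at_scale`), and §5's bound becomes, for
`‖v‖∞ ≥ 4` and EVERY `N ≥ 1`,
`|N⁸·dressedEntry w (K − truncK K N) (N•v) a b − N⁶·(K − truncK K N) a b (N•v)| ≤ A_out/‖v‖∞⁷`,
`A_out := C·c²·e^{δ/2}²·(1+4/δ)⁸·(128·(4/3)⁷·(2/δ) + 4096·16⁷·5040·(2/δ)⁷)` — FREE OF `N`. [folklore] -/
theorem abs_transport_tail_sub_le_outer {K w : EKer 4} {C c δ : ℝ} {N : ℕ} (hN : 1 ≤ N) (hδ : 0 < δ) (hc : 0 ≤ c)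
    (hK : ∀ c' e (t : Pt), |K c' e t| ≤ C / ((supNorm t : ℝ) + 1) ^ 6)
    (hdK : ∀ c' e (t : Pt) (i : Fin 4), |K c' e (t + Pi.single i 1) - K c' e t| ≤ C / ((supNorm t : ℝ) + 1) ^ 7)
    (hw0 : ∀ κ l, ConstReproSum N (w κ l) (if κ = l then (((N : ℝ) ^ (4 + 1))⁻¹) else 0))
    (hw : ∀ κ l x, |w κ l x| ≤ c / (N : ℝ) ^ 5 * Real.exp (-(δ / N) * l1 x))
    (a b : Fin 4) {v : Pt} (hv : 4 ≤ supNorm v) :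
    |(N : ℝ) ^ 8 * dressedEntry w (K - truncK K N) ((N : ℤ) • v) a b - (N : ℝ) ^ 6 * (K - truncK K N) a b ((N : ℤ) • v)|
      ≤ C * c ^ 2 * Real.exp (δ / 2) ^ 2 * (1 + 4 / δ) ^ 8
          * (128 * (4 / 3 : ℝ) ^ 7 * (2 / δ) + 4096 * 16 ^ 7 * 5040 * (2 / δ) ^ 7) / (supNorm v : ℝ) ^ 7 := by
  have hN' : (1 : ℝ) ≤ N := by exact_mod_cast hN
  have hX : (0 : ℝ) < N := by linarith
  have hC := nonneg_of_decay hK a b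
  have hc' : 0 ≤ c / (N : ℝ) ^ 5 := by positivity
  -- the letters at scale
  have hS : ∀ κ l, Summable fun x => (l1 x + 1) ^ 7 * |w κ l x| := fun κ l => (letter_at_scale hδ hN hc' (hw κ l) 7).1
  have hL0 : ∀ κ l, ∑' x, |w κ l x| ≤ c / (N : ℝ) ^ 5 * (Real.exp (δ / 2) * (1 + 4 / δ) ^ 4) * (N : ℝ) ^ 4 := by
    intro κ l
    have h := (letter_at_scale (D := 4) hδ hN hc' (hw κ l) 0).2
    simp only [pow_zero, one_mul, Nat.factorial_zero, Nat.cast_one, mul_one, zero_add] at h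
    exact h
  have hL1 : ∀ κ l, ∑' x, (l1 x + 1) * |w κ l x| ≤ c / (N : ℝ) ^ 5 * (Real.exp (δ / 2) * (2 / δ) * (1 + 4 / δ) ^ 4) * (N : ℝ) ^ 5 := by
    intro κ l
    have h := (letter_at_scale (D := 4) hδ hN hc' (hw κ l) 1).2
    simp only [pow_one, Nat.factorial_one, Nat.cast_one, one_mul] at h
    exact h
  have hL7 : ∀ κ l, ∑' x, (l1 x + 1) ^ 7 * |w κ l x|
      ≤ c / (N : ℝ) ^ 5 * ((5040 : ℝ) * Real.exp (δ / 2) * (2 / δ) ^ 7 * (1 + 4 / δ) ^ 4) * (N : ℝ) ^ 11 := by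
    intro κ l
    have h := (letter_at_scale (D := 4) hδ hN hc' (hw κ l) 7).2
    have e : ((Nat.factorial 7 : ℕ) : ℝ) = 5040 := by norm_num [Nat.factorial]
    rw [e] at h
    exact h
  have hmain := abs_transport_tail_sub_le_of_letters hN hK hdK hw0 hS hL0 hL1 hL7 a b hv
  refine hmain.trans ?_
  obtain ⟨hρ1, _, hρ16⟩ := rho_bounds hN hv
  -- real-number bookkeeping
  set X : ℝ := (N : ℝ) with hXdef
  set n : ℝ := (supNorm v : ℝ) with hndef
  set ρ : ℝ := ((N * (supNorm v / 4) : ℕ) : ℝ) with hρdef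
  have hn : (4 : ℝ) ≤ n := by rw [hndef]; exact_mod_cast hv
  have hρpos : (0 : ℝ) < ρ := by rw [hρdef]; exact_mod_cast hρ1
  have h16 : X * n ≤ 16 * ρ := by rw [hXdef, hndef, hρdef]; exact_mod_cast hρ16
  set E : ℝ := Real.exp (δ / 2) with hE
  set Q : ℝ := (1 + 4 / δ) ^ 4 with hQ
  have hEpos : 0 < E := Real.exp_pos _
  have hQpos : 0 < Q := by positivity
  -- term 1 is an equality, term 2 an inequality
  have t1 : 16 * X ^ 8 * (4 * (C * (4 / 3 : ℝ) ^ 7 / (X * n) ^ 7)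
        * (2 * (c / X ^ 5 * (E * (2 / δ) * Q) * X ^ 5) * (c / X ^ 5 * (E * Q) * X ^ 4)))
      = C * c ^ 2 * E ^ 2 * (1 + 4 / δ) ^ 8 * (128 * (4 / 3 : ℝ) ^ 7 * (2 / δ)) / n ^ 7 := by
    rw [hQ]; field_simp; ring
  have t2 : 16 * X ^ 8 * (128 * (C / (X + 1) ^ 6) / ρ ^ 7
        * (2 * (c / X ^ 5 * ((5040 : ℝ) * E * (2 / δ) ^ 7 * Q) * X ^ 11) * (c / X ^ 5 * (E * Q) * X ^ 4)))
      ≤ C * c ^ 2 * E ^ 2 * (1 + 4 / δ) ^ 8 * (4096 * 16 ^ 7 * 5040 * (2 / δ) ^ 7) / n ^ 7 := by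
    have key : X ^ 13 * n ^ 7 ≤ (X + 1) ^ 6 * (16 * ρ) ^ 7 := by
      rw [show X ^ 13 * n ^ 7 = X ^ 6 * (X * n) ^ 7 by ring]
      exact mul_le_mul (pow_le_pow_left₀ hX.le (by linarith) 6) (pow_le_pow_left₀ (by positivity) h16 7)
        (by positivity) (by positivity)
    have lhs : 16 * X ^ 8 * (128 * (C / (X + 1) ^ 6) / ρ ^ 7
          * (2 * (c / X ^ 5 * ((5040 : ℝ) * E * (2 / δ) ^ 7 * Q) * X ^ 11) * (c / X ^ 5 * (E * Q) * X ^ 4)))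
        = (C * c ^ 2 * E ^ 2 * (1 + 4 / δ) ^ 8 * (4096 * 5040 * (2 / δ) ^ 7)) * (X ^ 13 / ((X + 1) ^ 6 * ρ ^ 7)) := by
      rw [hQ]; field_simp; ring
    have rhs : C * c ^ 2 * E ^ 2 * (1 + 4 / δ) ^ 8 * (4096 * 16 ^ 7 * 5040 * (2 / δ) ^ 7) / n ^ 7
        = (C * c ^ 2 * E ^ 2 * (1 + 4 / δ) ^ 8 * (4096 * 5040 * (2 / δ) ^ 7)) * (16 ^ 7 / n ^ 7) := by ring
    rw [lhs, rhs]
    refine mul_le_mul_of_nonneg_left ?_ (by positivity)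
    rw [div_le_div_iff₀ (by positivity) (by positivity)]
    calc X ^ 13 * n ^ 7 ≤ (X + 1) ^ 6 * (16 * ρ) ^ 7 := key
      _ = 16 ^ 7 * ((X + 1) ^ 6 * ρ ^ 7) := by ring
  rw [mul_add (16 * X ^ 8), t1]
  have split : C * c ^ 2 * E ^ 2 * (1 + 4 / δ) ^ 8 * (128 * (4 / 3 : ℝ) ^ 7 * (2 / δ) + 4096 * 16 ^ 7 * 5040 * (2 / δ) ^ 7) / n ^ 7
      = C * c ^ 2 * E ^ 2 * (1 + 4 / δ) ^ 8 * (128 * (4 / 3 : ℝ) ^ 7 * (2 / δ)) / n ^ 7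
        + C * c ^ 2 * E ^ 2 * (1 + 4 / δ) ^ 8 * (4096 * 16 ^ 7 * 5040 * (2 / δ) ^ 7) / n ^ 7 := by ring
  rw [split]
  linarith

/-- **CORE REGION** (`‖v‖∞ ≤ 3`, in fact every `v`): both terms are `O(1)` by power counting —
`|N⁸·dressedEntry w (K − truncK K N) (N•v) a b| ≤ 16·N⁸·(C/(N+1)⁶)·L₀² ≤ 16·C·c²·β₀²` and `|N⁶·(K − truncK K N) a b (N•v)| ≤ C`. [folklore] -/
theorem abs_transport_tail_le_core {K w : EKer 4} {C c δ : ℝ} {N : ℕ} (hN : 1 ≤ N) (hδ : 0 < δ) (hc : 0 ≤ c)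
    (hK : ∀ c' e (t : Pt), |K c' e t| ≤ C / ((supNorm t : ℝ) + 1) ^ 6)
    (hw : ∀ κ l x, |w κ l x| ≤ c / (N : ℝ) ^ 5 * Real.exp (-(δ / N) * l1 x)) (a b : Fin 4) (v : Pt) :
    |(N : ℝ) ^ 8 * dressedEntry w (K - truncK K N) ((N : ℤ) • v) a b - (N : ℝ) ^ 6 * (K - truncK K N) a b ((N : ℤ) • v)|
      ≤ 16 * C * c ^ 2 * (Real.exp (δ / 2) * (1 + 4 / δ) ^ 4) ^ 2 + C := by
  have hN' : (1 : ℝ) ≤ N := by exact_mod_cast hN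
  have hX : (0 : ℝ) < N := by linarith
  have hC := nonneg_of_decay hK a b
  have hc' : 0 ≤ c / (N : ℝ) ^ 5 := by positivity
  set T : EKer 4 := K - truncK K N with hT
  set y : Pt := (N : ℤ) • v with hy
  -- first term
  have hL0 : ∀ κ l, (Summable fun x => |w κ l x|) ∧ ∑' x, |w κ l x| ≤ c / (N : ℝ) ^ 5 * (Real.exp (δ / 2) * (1 + 4 / δ) ^ 4) * (N : ℝ) ^ 4 := by
    intro κ l
    have h := letter_at_scale (D := 4) hδ hN hc' (hw κ l) 0
    simp only [pow_zero, one_mul, Nat.factorial_zero, Nat.cast_one, mul_one, zero_add] at h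
    exact h
  have hTA : ∀ c' e (t : Pt), |T c' e t| ≤ C / ((N : ℝ) + 1) ^ 6 := fun c' e t => abs_tail_le hK c' e t
  have hfib : ∀ c' e, |dressedSum (w c' a) (T c' e) (w e b) y|
      ≤ C / ((N : ℝ) + 1) ^ 6 * (c / (N : ℝ) ^ 5 * (Real.exp (δ / 2) * (1 + 4 / δ) ^ 4) * (N : ℝ) ^ 4) ^ 2 := by
    intro c' e
    have hs := (hasSum_abs_mul_abs (hL0 c' a).1 (hL0 e b).1).mul_left (C / ((N : ℝ) + 1) ^ 6)
    have h1 : ‖∑' p : Pt × Pt, w c' a p.1 * T c' e (y + p.1 - p.2) * w e b p.2‖ ≤ _ :=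
      tsum_of_norm_bounded hs (fun p => by
        rw [Real.norm_eq_abs, abs_mul, abs_mul]
        calc |w c' a p.1| * |T c' e (y + p.1 - p.2)| * |w e b p.2| ≤ |w c' a p.1| * (C / ((N : ℝ) + 1) ^ 6) * |w e b p.2| := by
              gcongr; exact hTA c' e _
          _ = C / ((N : ℝ) + 1) ^ 6 * (|w c' a p.1| * |w e b p.2|) := by ring)
    rw [Real.norm_eq_abs] at h1
    unfold dressedSum
    refine h1.trans ?_
    have n0 : ∀ κ l, 0 ≤ ∑' x, |w κ l x| := fun κ l => tsum_nonneg fun x => abs_nonneg _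
    rw [sq]
    gcongr
    · exact (hL0 c' a).2
    · exact (hL0 e b).2
  have hfirst : |(N : ℝ) ^ 8 * dressedEntry w T y a b| ≤ 16 * C * c ^ 2 * (Real.exp (δ / 2) * (1 + 4 / δ) ^ 4) ^ 2 := by
    rw [abs_mul, abs_of_nonneg (by positivity : (0 : ℝ) ≤ (N : ℝ) ^ 8)]
    unfold dressedEntry
    have h16 : |∑ c', ∑ e, dressedSum (w c' a) (T c' e) (w e b) y|
        ≤ 16 * (C / ((N : ℝ) + 1) ^ 6 * (c / (N : ℝ) ^ 5 * (Real.exp (δ / 2) * (1 + 4 / δ) ^ 4) * (N : ℝ) ^ 4) ^ 2) := by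
      refine (Finset.abs_sum_le_sum_abs _ _).trans ?_
      calc ∑ c', |∑ e, dressedSum (w c' a) (T c' e) (w e b) y|
          ≤ ∑ _c' : Fin 4, 4 * (C / ((N : ℝ) + 1) ^ 6 * (c / (N : ℝ) ^ 5 * (Real.exp (δ / 2) * (1 + 4 / δ) ^ 4) * (N : ℝ) ^ 4) ^ 2) := by
            refine Finset.sum_le_sum fun c' _ => (Finset.abs_sum_le_sum_abs _ _).trans ?_
            calc ∑ e, |dressedSum (w c' a) (T c' e) (w e b) y|
                ≤ ∑ _e : Fin 4, C / ((N : ℝ) + 1) ^ 6 * (c / (N : ℝ) ^ 5 * (Real.exp (δ / 2) * (1 + 4 / δ) ^ 4) * (N : ℝ) ^ 4) ^ 2 :=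
                  Finset.sum_le_sum fun e _ => hfib c' e
              _ = _ := by rw [Finset.sum_const, Finset.card_univ, Fintype.card_fin, nsmul_eq_mul]; norm_num
        _ = _ := by rw [Finset.sum_const, Finset.card_univ, Fintype.card_fin, nsmul_eq_mul]; norm_num; ring
    refine (mul_le_mul_of_nonneg_left h16 (by positivity)).trans ?_
    -- `N⁸ · 16 · C/(N+1)⁶ · (c β₀ N⁻¹)² ≤ 16 C c² β₀²`
    have hfrac : (N : ℝ) ^ 8 * (1 / ((N : ℝ) + 1) ^ 6 * ((N : ℝ) ^ 4 / (N : ℝ) ^ 5) ^ 2) ≤ 1 := by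
      rw [show (N : ℝ) ^ 4 / (N : ℝ) ^ 5 = 1 / (N : ℝ) by field_simp]
      rw [show (N : ℝ) ^ 8 * (1 / ((N : ℝ) + 1) ^ 6 * (1 / (N : ℝ)) ^ 2) = (N : ℝ) ^ 6 / ((N : ℝ) + 1) ^ 6 by field_simp]
      rw [div_le_one (by positivity)]
      exact pow_le_pow_left₀ hX.le (by linarith) 6
    have e : (N : ℝ) ^ 8 * (16 * (C / ((N : ℝ) + 1) ^ 6 * (c / (N : ℝ) ^ 5 * (Real.exp (δ / 2) * (1 + 4 / δ) ^ 4) * (N : ℝ) ^ 4) ^ 2))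
        = (16 * C * c ^ 2 * (Real.exp (δ / 2) * (1 + 4 / δ) ^ 4) ^ 2)
          * ((N : ℝ) ^ 8 * (1 / ((N : ℝ) + 1) ^ 6 * ((N : ℝ) ^ 4 / (N : ℝ) ^ 5) ^ 2)) := by ring
    rw [e]
    exact (mul_le_mul_of_nonneg_left hfrac (by positivity)).trans (le_of_eq (mul_one _))
  -- second term
  have hsecond : |(N : ℝ) ^ 6 * T a b y| ≤ C := by
    rw [abs_mul, abs_of_nonneg (by positivity : (0 : ℝ) ≤ (N : ℝ) ^ 6), hT, tail_apply]
    split_ifs with h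
    · rw [abs_zero, mul_zero]; exact hC
    · have hlt := not_le.mp h
      rw [hy, supNorm_natCast_smul] at hlt
      have hv1 : 1 ≤ supNorm v := by
        rcases Nat.eq_zero_or_pos (supNorm v) with h0 | h0
        · rw [h0, mul_zero] at hlt; exact absurd hlt (Nat.not_lt_zero _)
        · exact h0
      have hge : (N : ℝ) ≤ (supNorm y : ℝ) + 1 := by
        rw [hy, supNorm_natCast_smul]; push_cast
        have : (N : ℝ) * 1 ≤ (N : ℝ) * (supNorm v : ℝ) := mul_le_mul_of_nonneg_left (by exact_mod_cast hv1) hX.le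
        linarith
      calc (N : ℝ) ^ 6 * |K a b y| ≤ (N : ℝ) ^ 6 * (C / ((supNorm y : ℝ) + 1) ^ 6) := mul_le_mul_of_nonneg_left (hK a b y) (by positivity)
        _ ≤ (N : ℝ) ^ 6 * (C / (N : ℝ) ^ 6) := by gcongr
        _ = C := by field_simp
  calc |(N : ℝ) ^ 8 * dressedEntry w T y a b - (N : ℝ) ^ 6 * T a b y|
      ≤ |(N : ℝ) ^ 8 * dressedEntry w T y a b| + |(N : ℝ) ^ 6 * T a b y| := abs_sub _ _
    _ ≤ _ := add_le_add hfirst hsecond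

end Profile


end Summit.QuantumFields.BalabanUV.Beta.FP.HorizontalBookkeepingTailPointwise

end
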